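/-
Copyright (c) 2026. All rights reserved.
Released under Apache 2.0 license as described in the file LICENSE.
Authors: HodgeCM publication cell (pub-hodgecm), GR lane, third hand (`pub-hodgecm-own-crow`).
-/
import Mathlib.MeasureTheory.Integral.Lebesgue.Add
import Mathlib.MeasureTheory.Integral.Lebesgue.Sub
import Mathlib.MeasureTheory.Function.LpSpace.Basic
import Mathlib.Topology.Instances.ENNReal.Lemmas
import Mathlib.Analysis.SpecialFunctions.Pow.Continuity
import HarnessLib

/-!
# `L²` convergence from almost-everywhere convergence and convergence of the `L²` norms

Topic `MeasureTheory/Integral`; namespace `Literature.MeasureTheory.Integral`.  KERNEL ONLY: theorems; no definition, no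
named fact, no `sorry`.

**Theorem** (Riesz; the `p = 2` case of the corollary of the Brezis–Lieb "missing term in Fatou's lemma",
[LiebLoss2001, Thm. 1.9 and the remark following it]).  Let `f_k, g : α → E` (`E` a normed group) be a.e.-strongly
measurable with `f_k → g` almost everywhere, `∫⁻ ‖g‖ₑ² dμ < ∞`, and `∫⁻ ‖f_k‖ₑ² dμ → ∫⁻ ‖g‖ₑ² dμ`.  Then
`∫⁻ ‖f_k - g‖ₑ² dμ → 0` (`tendsto_lintegral_enorm_sub_sq_of_tendsto_ae`).

Proof (Fatou): `h_k = 2‖f_k‖ₑ² + 2‖g‖ₑ² - ‖f_k - g‖ₑ² ≥ 0` tends a.e. to `4‖g‖ₑ²`, so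
`4∫‖g‖² ≤ liminf (2∫‖f_k‖² + 2∫‖g‖² - ∫‖f_k - g‖²)`; if `∫‖f_k - g‖² ≥ ε` frequently, the right side is at most
`4∫‖g‖² - ε/2`, a contradiction (the case `∫‖g‖² = 0` is the squeeze `∫‖f_k - g‖² ≤ 2∫‖f_k‖² + 2∫‖g‖² → 0`).  The
statement is for sequences (a countably generated filter would do); measures and spaces are arbitrary.

Use (GR lane of the Hodge/COR-CM cell, ROADMAP (A3)): for a family of Schwartz–Bruhat functions `z ↦ ω(t z)Φ` that is
pointwise continuous (the coefficient topology of `Mp_ψ(W_𝐀)`) and whose `L²` norms are continuous in `z` (e.g. constant: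
`L²`-isometric operators), this gives `L²`-continuity from a first-countable parameter space — the input of
`Weil1964.adelicMpCont.continuous_toOp_unitaryLeg_comp_apply` — with no dominating majorant.

## References
* [LiebLoss2001] E. H. Lieb, M. Loss, *Analysis*, 2nd ed., GSM 14 (2001), Thm. 1.9 (Brezis–Lieb lemma) and the remark
  after it (`‖f_k‖_p → ‖f‖_p` and a.e. convergence imply `‖f_k - f‖_p → 0`).
-/

set_option autoImplicit false

noncomputable section

open _root_.MeasureTheory Filter Topology
open scoped ENNReal

namespace Literature.MeasureTheory.Integral

variable {α : Type*} [MeasurableSpace α] {μ : Measure α}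
variable {E : Type*} [NormedAddCommGroup E]

/-- the parallelogram inequality for the extended norm: `‖a - b‖ₑ² ≤ 2‖a‖ₑ² + 2‖b‖ₑ²`. [folklore] -/
private theorem enorm_sub_sq_le (a b : E) : ‖a - b‖ₑ ^ 2 ≤ 2 * ‖a‖ₑ ^ 2 + 2 * ‖b‖ₑ ^ 2 := by
  have h1 : ‖a - b‖ₑ ^ 2 ≤ (‖a‖ₑ + ‖b‖ₑ) ^ 2 := pow_le_pow_left' (enorm_sub_le (E := E)) 2
  refine h1.trans ?_
  have h2 : ((‖a‖₊ + ‖b‖₊ : NNReal) : ℝ≥0∞) ^ 2 ≤ ((2 * ‖a‖₊ ^ 2 + 2 * ‖b‖₊ ^ 2 : NNReal) : ℝ≥0∞) := by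
    have h : ((‖a‖₊ + ‖b‖₊) ^ 2 : NNReal) ≤ 2 * ‖a‖₊ ^ 2 + 2 * ‖b‖₊ ^ 2 := by
      rw [← NNReal.coe_le_coe]
      push_cast
      nlinarith [sq_nonneg (‖a‖ - ‖b‖), add_sq ‖a‖ ‖b‖, sub_sq ‖a‖ ‖b‖]
    exact_mod_cast h
  simpa only [enorm_eq_nnnorm, ENNReal.coe_add, ENNReal.coe_mul, ENNReal.coe_pow, ENNReal.coe_ofNat] using h2

/-- **`L²` CONVERGENCE FROM A.E. CONVERGENCE AND CONVERGENCE OF THE `L²` NORMS** (Riesz / Brezis–Lieb, `p = 2`): if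
`f_k → g` a.e., `∫⁻ ‖g‖ₑ² < ∞` and `∫⁻ ‖f_k‖ₑ² → ∫⁻ ‖g‖ₑ²`, then `∫⁻ ‖f_k - g‖ₑ² → 0`.
[cite: LiebLoss2001, Thm. 1.9] -/
theorem tendsto_lintegral_enorm_sub_sq_of_tendsto_ae {f : ℕ → α → E} {g : α → E}
    (hf : ∀ k, AEStronglyMeasurable (f k) μ) (hg : AEStronglyMeasurable g μ)
    (hf2 : ∀ k, ∫⁻ x, ‖f k x‖ₑ ^ 2 ∂μ ≠ ∞) (hg2 : ∫⁻ x, ‖g x‖ₑ ^ 2 ∂μ ≠ ∞)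
    (hlim : ∀ᵐ x ∂μ, Tendsto (fun k => f k x) atTop (𝓝 (g x)))
    (hnorm : Tendsto (fun k => ∫⁻ x, ‖f k x‖ₑ ^ 2 ∂μ) atTop (𝓝 (∫⁻ x, ‖g x‖ₑ ^ 2 ∂μ))) :
    Tendsto (fun k => ∫⁻ x, ‖f k x - g x‖ₑ ^ 2 ∂μ) atTop (𝓝 0) := by
  -- notation
  set N : ℝ≥0∞ := ∫⁻ x, ‖g x‖ₑ ^ 2 ∂μ with hN_def
  set Nk : ℕ → ℝ≥0∞ := fun k => ∫⁻ x, ‖f k x‖ₑ ^ 2 ∂μ with hNk_def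
  set D : ℕ → ℝ≥0∞ := fun k => ∫⁻ x, ‖f k x - g x‖ₑ ^ 2 ∂μ with hD_def
  change Tendsto D atTop (𝓝 0)
  have hnorm' : Tendsto Nk atTop (𝓝 N) := hnorm
  -- measurability
  have hmf : ∀ k, AEMeasurable (fun x => ‖f k x‖ₑ ^ 2) μ := fun k => (hf k).enorm.pow_const 2
  have hmg : AEMeasurable (fun x => ‖g x‖ₑ ^ 2) μ := hg.enorm.pow_const 2
  have hmd : ∀ k, AEMeasurable (fun x => ‖f k x - g x‖ₑ ^ 2) μ := fun k => ((hf k).sub hg).enorm.pow_const 2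
  -- the bound `D k ≤ 2 Nk k + 2 N < ∞`
  have hsum : ∀ k, ∫⁻ x, (2 * ‖f k x‖ₑ ^ 2 + 2 * ‖g x‖ₑ ^ 2) ∂μ = 2 * Nk k + 2 * N := by
    intro k
    rw [lintegral_add_left' ((hmf k).const_mul 2), lintegral_const_mul'' _ (hmf k), lintegral_const_mul'' _ hmg]
  have hDle : ∀ k, D k ≤ 2 * Nk k + 2 * N := fun k =>
    (lintegral_mono fun x => enorm_sub_sq_le (f k x) (g x)).trans (hsum k).le
  have hfin : ∀ k, 2 * Nk k + 2 * N ≠ ∞ := fun k =>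
    ENNReal.add_ne_top.2 ⟨ENNReal.mul_ne_top ENNReal.ofNat_ne_top (hf2 k), ENNReal.mul_ne_top ENNReal.ofNat_ne_top hg2⟩
  have hDfin : ∀ k, D k ≠ ∞ := fun k => ne_top_of_le_ne_top (hfin k) (hDle k)
  -- `2 Nk k + 2 N → 4 N`
  have h4 : Tendsto (fun k => 2 * Nk k + 2 * N) atTop (𝓝 (4 * N)) := by
    have h := (ENNReal.Tendsto.const_mul hnorm' (Or.inr (ENNReal.ofNat_ne_top (n := 2)))).add
      (tendsto_const_nhds (x := 2 * N))
    have e : 2 * N + 2 * N = 4 * N := by rw [← add_mul]; norm_num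
    rwa [e] at h
  -- the trivial case `N = 0`: squeeze
  by_cases hN0 : N = 0
  · rw [show 4 * N = 0 by rw [hN0, mul_zero]] at h4
    exact tendsto_of_tendsto_of_tendsto_of_le_of_le tendsto_const_nhds h4 (fun _ => zero_le) hDle
  -- Fatou for `h_k = 2‖f_k‖ₑ² + 2‖g‖ₑ² - ‖f_k - g‖ₑ² ≥ 0`, which tends a.e. to `4‖g‖ₑ²`
  have hFatou : 4 * N ≤ liminf (fun k => 2 * Nk k + 2 * N - D k) atTop := by
    have hptw : ∀ᵐ x ∂μ, liminf (fun k => 2 * ‖f k x‖ₑ ^ 2 + 2 * ‖g x‖ₑ ^ 2 - ‖f k x - g x‖ₑ ^ 2) atTop =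
        4 * ‖g x‖ₑ ^ 2 := by
      filter_upwards [hlim] with x hx
      have h1 : Tendsto (fun k => ‖f k x‖ₑ ^ 2) atTop (𝓝 (‖g x‖ₑ ^ 2)) := ENNReal.Tendsto.pow hx.enorm
      have h2 : Tendsto (fun k => ‖f k x - g x‖ₑ ^ 2) atTop (𝓝 0) := by
        have h := ENNReal.Tendsto.pow (n := 2) (hx.sub (tendsto_const_nhds (x := g x))).enorm
        rwa [sub_self, enorm_zero, zero_pow two_ne_zero] at h
      have h3 : Tendsto (fun k => 2 * ‖f k x‖ₑ ^ 2 + 2 * ‖g x‖ₑ ^ 2 - ‖f k x - g x‖ₑ ^ 2) atTop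
          (𝓝 (2 * ‖g x‖ₑ ^ 2 + 2 * ‖g x‖ₑ ^ 2 - 0)) :=
        ENNReal.Tendsto.sub ((ENNReal.Tendsto.const_mul h1 (Or.inr (ENNReal.ofNat_ne_top (n := 2)))).add
          tendsto_const_nhds) h2 (Or.inr ENNReal.zero_ne_top)
      rw [h3.liminf_eq, tsub_zero, ← add_mul]
      norm_num
    have hmeas : ∀ k, AEMeasurable (fun x => 2 * ‖f k x‖ₑ ^ 2 + 2 * ‖g x‖ₑ ^ 2 - ‖f k x - g x‖ₑ ^ 2) μ :=
      fun k => (((hmf k).const_mul 2).add (hmg.const_mul 2)).sub (hmd k)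
    have h := lintegral_liminf_le' (μ := μ) (u := atTop) hmeas
    rw [lintegral_congr_ae hptw, lintegral_const_mul'' _ hmg] at h
    refine h.trans (le_of_eq (liminf_congr (Eventually.of_forall fun k => ?_)))
    rw [lintegral_sub' (hmd k) (hDfin k) (Eventually.of_forall fun x => enorm_sub_sq_le (f k x) (g x)), hsum k]
  -- conclusion: if `D k ≥ ε` frequently, the liminf is at most `4N - ε/2 < 4N`
  have h4N : 4 * N ≠ ∞ := ENNReal.mul_ne_top ENNReal.ofNat_ne_top hg2
  have h4N0 : 4 * N ≠ 0 := mul_ne_zero four_ne_zero hN0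
  rw [ENNReal.tendsto_nhds_zero]
  intro ε hε
  by_contra hcon
  have hfreq : ∃ᶠ k in atTop, ε < D k := by
    simpa only [not_eventually, not_le] using hcon
  have hε2 : ε / 2 ≠ 0 := (ENNReal.half_pos hε.ne').ne'
  have hev : ∀ᶠ k in atTop, 2 * Nk k + 2 * N ≤ 4 * N + ε / 2 :=
    ((ENNReal.tendsto_nhds h4N).1 h4 (ε / 2) (ENNReal.half_pos hε.ne')).mono fun k hk => hk.2
  have hfreq' : ∃ᶠ k in atTop, 2 * Nk k + 2 * N - D k ≤ 4 * N - ε / 2 := by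
    refine (hfreq.and_eventually hev).mono ?_
    rintro k ⟨hk1, hk2⟩
    have hεtop : ε ≠ ∞ := ne_top_of_lt (hk1.trans_le le_top)
    have hε2top : ε / 2 ≠ ∞ := ne_top_of_lt ((ENNReal.half_lt_self hε.ne' hεtop).trans_le le_top)
    calc 2 * Nk k + 2 * N - D k ≤ (4 * N + ε / 2) - ε := tsub_le_tsub hk2 hk1.le
      _ = 4 * N - ε / 2 := by
          nth_rewrite 2 [← ENNReal.add_halves ε]
          exact ENNReal.add_sub_add_eq_sub_right hε2top
  have hle : 4 * N ≤ 4 * N - ε / 2 := hFatou.trans (liminf_le_of_frequently_le' hfreq')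
  exact absurd hle (not_le.2 (ENNReal.sub_lt_self h4N h4N0 hε2))

/-- the same, read as **continuity**: along a sequence `z_k → z`, a family `k ↦ F (z_k)` of square-integrable
functions converging pointwise a.e. to `F z` with `∫⁻ ‖F z_k‖ₑ² → ∫⁻ ‖F z‖ₑ²` converges in `L²`-seminorm:
`eLpNorm (F z_k - F z) 2 μ → 0`. [cite: LiebLoss2001, Thm. 1.9] -/
theorem tendsto_eLpNorm_two_sub_of_tendsto_ae {f : ℕ → α → E} {g : α → E}
    (hf : ∀ k, AEStronglyMeasurable (f k) μ) (hg : AEStronglyMeasurable g μ)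
    (hf2 : ∀ k, ∫⁻ x, ‖f k x‖ₑ ^ 2 ∂μ ≠ ∞) (hg2 : ∫⁻ x, ‖g x‖ₑ ^ 2 ∂μ ≠ ∞)
    (hlim : ∀ᵐ x ∂μ, Tendsto (fun k => f k x) atTop (𝓝 (g x)))
    (hnorm : Tendsto (fun k => ∫⁻ x, ‖f k x‖ₑ ^ 2 ∂μ) atTop (𝓝 (∫⁻ x, ‖g x‖ₑ ^ 2 ∂μ))) :
    Tendsto (fun k => eLpNorm (f k - g) 2 μ) atTop (𝓝 0) := by
  have h := tendsto_lintegral_enorm_sub_sq_of_tendsto_ae hf hg hf2 hg2 hlim hnorm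
  have hrpow : Tendsto (fun k => (∫⁻ x, ‖f k x - g x‖ₑ ^ 2 ∂μ) ^ (1 / 2 : ℝ)) atTop (𝓝 0) := by
    have := ((ENNReal.continuous_rpow_const (y := (1 / 2 : ℝ))).tendsto 0).comp h
    rwa [ENNReal.zero_rpow_of_pos (by norm_num : (0 : ℝ) < 1 / 2)] at this
  refine hrpow.congr fun k => ?_
  rw [eLpNorm_eq_lintegral_rpow_enorm_toReal two_ne_zero ENNReal.ofNat_ne_top, ENNReal.toReal_ofNat]
  congr 1
  refine lintegral_congr fun x => ?_
  rw [Pi.sub_apply, ← ENNReal.rpow_natCast]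
  norm_num

end Literature.MeasureTheory.Integral

end
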